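import Summits.AtomisticToContinuum.BoseEinsteinCondensation.Theorems.BECThomsonPrincipleFibreFubini
import Summits.AtomisticToContinuum.BoseEinsteinCondensation.Theorems.FibreConductance.Negative.InfraredBridge
import Literature.MathematicalPhysics.QuantumManyBody.JelliumBochnerFibre
import HarnessLib

/-!
# Route `BECThomsonPrinciple`, crux `FibreConductance` (stmt-AtomisticToContinuum-9480),
# line `parseval-shell-bootstrap` — INFRARED NECESSITY

The certificate that the held stub `stub_shellOccupation` (single-mode occupation bounds next to
the resonant mode `−n`) is crux-sized: the crux `FibreConductance` ITSELF forces, on every exact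
zero-free datum and for every lattice mode `P`,

  `∫_{cell^N} W(X̂) |ĉ_P(e_n ψ(·|X̂) − β(X̂) ψ(·|X̂)²)|² dX ≤ 4π² C |P|₂² / ‖n‖²`

(`infraredNecessity`; `ĉ_P = cellFourierCoeff`, `W = fibreW`, `ψ = fibrePsi`, `β = fibreBeta` of
`BECThomsonPrincipleDefs`).  Since `ĉ_P(e_n ψ) = ĉ_{P−n}(ψ)` and `∫ W|ĉ_q(ψ)|² = n_q(|Φ|)/N`
(`lintegral_fibreW_mul_norm_sq_cellFourierCoeff`), this is an `N`-uniform bound on the occupation of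
the modes `P − n` with `P` lattice-adjacent to `0`, relative to the `β`-weighted density modes — the
thermodynamic-limit (infrared) content no line can drop.

The proof is pure Thomson duality (Disproof §D; no minimality, no potential): pair an admissible
flow `J` (weak divergence `q = L^{-3/2}(e_n(x₀)ψ − βψ²)`, cost `∫|J|²W/ψ² ≤ K = C L²/‖n‖²`) with
the test function `η = e_{−P}(x₀) · conj(A) · W`, where
`A(X̂) = ∫_cell conj(e_P)(e_n ψ − β ψ²) dy = L³ ĉ_P(…)` is a fibre constant:

* `∂_{0,l} η = −i k_{P,l} η` (a fibre constant has zero fibre derivative), so the dual energy is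
  `∫ Σ_l|∂_{0,l}η|² ψ²/W = L⁻³ |k_P|² S`, `S = ∫_{cell^N} |A|² W` (fibre Fubini, `∫_cell ψ² = 1`);
* the pairing is `∫ q η = L⁻³ L^{-3/2} S` (fibre by fibre `∫_cell q η dy = L^{-3/2} |A|² W`);
* Cauchy–Schwarz through the pairing (`norm_pairing_sq_le`): `L⁻⁹ S² ≤ K L⁻³ |k_P|² S`, i.e.
  `S ≤ K L⁶ |k_P|²`, and `S = L⁶ ∫ W |ĉ_P(…)|²`.

Registered anchor (`--supports` the crux item): `infraredNecessity`.

References: the line card `Cruxes/FibreConductance/Lines/parseval-shell-bootstrap.md`;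
R. Lyons, Y. Peres, *Probability on Trees and Networks* (2016), Ch. 2 (Thomson's principle) — used
only as the idea; the crux disprover's `Cruxes/FibreConductance/Disproof.lean` §Infrared, whose
computation this file adapts to the line's vocabulary.
-/

noncomputable section

namespace Summit.AtomisticToContinuum.BoseEinsteinCondensation.Cruxes.FibreConductance.ParsevalShellBootstrap

open MeasureTheory
open scoped ENNReal ComplexConjugate
open Literature.MathematicalPhysics.QuantumManyBody.BoseGas
open Summit.AtomisticToContinuum.BoseEinsteinCondensation.Theses.BECThomsonPrinciple (FibreConductance)
open Summit.AtomisticToContinuum.BoseEinsteinCondensation.Theorems.GaussianDominationCan.Negative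
  (nsq nsq_nonneg one_le_norm_intVec)
open Summit.AtomisticToContinuum.BoseEinsteinCondensation.Theorems.FibreConductance.Negative
  (IsFibreFlow norm_pairing_sq_le fderiv_single_zero_of_update_invariant fderiv_wave_comp_zero
    differentiable_wave_comp_zero)

variable {m : ℕ} {L : ℝ}

/-! ### Test functions `e_p(x₀) · G(X̂)` with a fibre-constant factor -/

/-- `|−P|² = |P|²`. [folklore] -/
theorem ir_nsq_neg (P : Fin 3 → ℤ) : nsq (-P) = nsq P := by
  simp [nsq]

/-- `Σ_l |(2πi p_l/L) c|² = (2π/L)² |p|² |c|²`. [folklore] -/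
theorem ir_sum_norm_sq_kmul (L : ℝ) (p : Fin 3 → ℤ) (c : ℂ) :
    ∑ l : Fin 3, ‖2 * Real.pi * Complex.I * (p l) / L * c‖ ^ 2 =
      (2 * Real.pi / L) ^ 2 * nsq p * ‖c‖ ^ 2 := by
  -- adapted from Cruxes/FibreConductance/Disproof.lean (`sum_norm_sq_fderiv_irTest`)
  have hc : ∀ l : Fin 3, ‖(2 * Real.pi * Complex.I * (p l) / L : ℂ)‖ ^ 2 =
      (2 * Real.pi / L) ^ 2 * (p l : ℝ) ^ 2 := by
    intro l
    rw [show (2 * Real.pi * Complex.I * (p l) / L : ℂ) =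
        ((2 * Real.pi * (p l : ℝ) / L : ℝ) : ℂ) * Complex.I by push_cast; ring,
      norm_mul, Complex.norm_I, mul_one, Complex.norm_real, Real.norm_eq_abs, sq_abs]
    ring
  simp_rw [norm_mul, mul_pow, hc]
  rw [← Finset.sum_mul, ← Finset.mul_sum]
  rfl

/-- `∂_{x_{0,l}} e_p(x₀) = (2πi p_l/L) e_p(x₀)` for the line's phase factor. [folklore] -/
theorem ir_fderiv_phase_zero (L : ℝ) (p : Fin 3 → ℤ) (X : Config (m + 1)) (l : Fin 3) :
    fderiv ℝ (fun Y : Config (m + 1) => phase L p (Y 0)) X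
        (Pi.single 0 (EuclideanSpace.single l 1)) =
      2 * Real.pi * Complex.I * (p l) / L * phase L p (X 0) :=
  fderiv_wave_comp_zero L p X l

/-- **Fibre gradient of `η = e_p(x₀)·G` for a fibre constant `G`**: `∂_{0,l}η = (2πi p_l/L) η`
(the fibre derivative of `G` vanishes). [folklore] -/
theorem ir_fderiv_test (p : Fin 3 → ℤ) {G : Config (m + 1) → ℂ}
    (hGu : ∀ X y, G (Function.update X 0 y) = G X) {X : Config (m + 1)}
    (hGd : DifferentiableAt ℝ G X) (l : Fin 3) :
    fderiv ℝ (fun Y : Config (m + 1) => phase L p (Y 0) * G Y) X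
        (Pi.single 0 (EuclideanSpace.single l 1)) =
      2 * Real.pi * Complex.I * (p l) / L * (phase L p (X 0) * G X) := by
  -- adapted from Cruxes/FibreConductance/Disproof.lean (`fderiv_irTest`)
  have hF : DifferentiableAt ℝ (fun Y : Config (m + 1) => phase L p (Y 0)) X :=
    differentiable_wave_comp_zero L p X
  rw [fderiv_fun_mul hF hGd, _root_.add_apply, _root_.smul_apply, _root_.smul_apply,
    fderiv_single_zero_of_update_invariant hGu hGd, ir_fderiv_phase_zero, smul_zero, zero_add,
    smul_eq_mul]
  ring

/-! ### Thomson duality against `η = e_{−P}(x₀) · conj(A) · W` -/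

/-- **The master inequality.** Let `J` be a fibre flow with weak divergence `σ` and Thomson cost
`∫|J|²W/ψ² ≤ K`, and let `A` be a `C¹`, periodic FIBRE CONSTANT such that the charge pairs with
`e_{−P} conj(A) W` fibre by fibre to `L^{-3/2}|A|²W`.  Then `∫_{cell^N} |A|² W ≤ K L⁶ |k_P|²`
(`k_P = 2πP/L`): Cauchy–Schwarz through the pairing with `η = e_{−P}(x₀) conj(A) W`, whose dual
energy is `L⁻³|k_P|² ∫|A|²W` and whose pairing is `L⁻³L^{-3/2} ∫|A|²W`. [folklore] -/
theorem ir_master (hL : 0 < L) (Φ : PeriodicTrialState (m + 1) L) (hΦ : ∀ X, Φ.ψ X ≠ 0)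
    {σ : Config (m + 1) → ℂ} (hσc : Continuous σ) {J : Config (m + 1) → Fin 3 → ℂ}
    (hJ : HasWeakDiv L J σ) {K : ℝ} (hK : 0 ≤ K) (hcost : fibreCost Φ J ≤ ENNReal.ofReal K)
    (P : Fin 3 → ℤ) {A : Config (m + 1) → ℂ} (hAd : ContDiff ℝ 1 A)
    (hAu : ∀ X y, A (Function.update X 0 y) = A X)
    (hAp : ∀ (X : Config (m + 1)) (i : Fin (m + 1)) (k : Fin 3),
      A (X + Pi.single i (EuclideanSpace.single k L)) = A X)
    (hpair : ∀ X : Config (m + 1),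
      ∫ y in cell L, σ (Function.update X 0 y) *
          (phase L (-P) y * (conj (A X) * (fibreW Φ X : ℂ))) =
        ((Real.sqrt (L ^ 3))⁻¹ : ℂ) * ((‖A X‖ ^ 2 * fibreW Φ X : ℝ) : ℂ)) :
    ∫ X in cellN (m + 1) L, ‖A X‖ ^ 2 * fibreW Φ X ≤
      K * L ^ 6 * ((2 * Real.pi / L) ^ 2 * nsq P) := by
  -- adapted from Cruxes/FibreConductance/Disproof.lean (`infraredNecessity`, `lintegral_dual_irTest`,
  -- `integral_fibreCharge_mul_irTest`)
  have hL3 : (0 : ℝ) < L ^ 3 := by positivity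
  have hWpos : ∀ X, 0 < fibreW Φ X := fibreW_pos hL Φ hΦ
  have hψpos : ∀ X, 0 < fibrePsi Φ X := fibrePsi_pos hL Φ hΦ
  have hAc : Continuous A := hAd.continuous
  have hWc : Continuous (fibreW Φ) := continuous_fibreW Φ
  have hψc : Continuous (fibrePsi Φ) := continuous_fibrePsi hL Φ hΦ
  set κ : ℝ := (2 * Real.pi / L) ^ 2 * nsq P with hκ
  have hκ0 : 0 ≤ κ := mul_nonneg (sq_nonneg _) (nsq_nonneg P)
  -- the test function
  set G : Config (m + 1) → ℂ := fun X => conj (A X) * (fibreW Φ X : ℂ) with hG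
  set η : Config (m + 1) → ℂ := fun X => phase L (-P) (X 0) * G X with hη
  have hGd : ContDiff ℝ 1 G :=
    (Complex.conjCLE.contDiff.comp hAd).mul (Complex.ofRealCLM.contDiff.comp (contDiff_fibreW Φ))
  have hGu : ∀ X y, G (Function.update X 0 y) = G X := fun X y => by
    simp only [hG, hAu, fibreW_update]
  have hηd : ContDiff ℝ 1 η :=
    ((contDiff_phase L (-P)).comp (contDiff_apply ℝ Space (0 : Fin (m + 1)))).mul hGd
  have hηp : ∀ (X : Config (m + 1)) (i : Fin (m + 1)) (k : Fin 3),
      η (X + Pi.single i (EuclideanSpace.single k L)) = η X := by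
    intro X i k
    simp only [hη, hG, hAp, fibreW_periodic]
    rcases eq_or_ne i 0 with rfl | hi
    · simp only [Pi.add_apply, Pi.single_eq_same, phase_periodic hL.ne']
    · simp only [Pi.add_apply, Pi.single_eq_of_ne hi.symm, add_zero]
  -- its fibre gradient
  have hfd : ∀ (X : Config (m + 1)) (l : Fin 3),
      fderiv ℝ η X (Pi.single 0 (EuclideanSpace.single l 1)) =
        2 * Real.pi * Complex.I * ((-P) l) / L * η X := fun X l =>
    ir_fderiv_test (-P) hGu ((hGd.differentiable one_ne_zero) X) l
  have hηn : ∀ X, ‖η X‖ = ‖A X‖ * fibreW Φ X := fun X => by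
    simp only [hη, hG]
    rw [norm_mul, norm_phase, one_mul, norm_mul, Complex.norm_conj, Complex.norm_real,
      Real.norm_of_nonneg (hWpos X).le]
  have hsum : ∀ X, ∑ l : Fin 3, ‖fderiv ℝ η X (Pi.single 0 (EuclideanSpace.single l 1))‖ ^ 2 =
      κ * (‖A X‖ ^ 2 * fibreW Φ X ^ 2) := fun X => by
    simp_rw [hfd X]
    rw [ir_sum_norm_sq_kmul, ir_nsq_neg, hηn, mul_pow]
  -- (1) the pairing `∫ σ η = L⁻³ L^{-3/2} S`
  have hpairing : ∫ X in cellN (m + 1) L, σ X * η X =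
      (((L ^ 3)⁻¹ * (Real.sqrt (L ^ 3))⁻¹ * ∫ X in cellN (m + 1) L, ‖A X‖ ^ 2 * fibreW Φ X : ℝ) :
        ℂ) := by
    have hcont : Continuous fun X => σ X * η X := hσc.mul hηd.continuous
    have h := Literature.MathematicalPhysics.QuantumManyBody.JelliumBoseGas.integral_cellN_integral_cell_update
      (0 : Fin (m + 1)) (integrableOn_cellN hcont L)
    have hfib : ∀ X, ∫ y in cell L, σ (Function.update X 0 y) * η (Function.update X 0 y) =
        ((Real.sqrt (L ^ 3))⁻¹ : ℂ) * ((‖A X‖ ^ 2 * fibreW Φ X : ℝ) : ℂ) := by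
      intro X
      have he : ∀ y, η (Function.update X 0 y) = phase L (-P) y * (conj (A X) * (fibreW Φ X : ℂ)) :=
        fun y => by simp only [hη, hG, Function.update_self, hAu, fibreW_update]
      simp_rw [he]
      exact hpair X
    simp_rw [hfib] at h
    rw [integral_const_mul, integral_complex_ofReal, Complex.real_smul] at h
    have e1 : ∫ X in cellN (m + 1) L, σ X * η X =
        ((L ^ 3 : ℝ) : ℂ)⁻¹ * (((Real.sqrt (L ^ 3))⁻¹ : ℂ) *
          ((∫ X in cellN (m + 1) L, ‖A X‖ ^ 2 * fibreW Φ X : ℝ) : ℂ)) := by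
      rw [h, ← mul_assoc, inv_mul_cancel₀ (by exact_mod_cast hL3.ne'), one_mul]
    rw [e1]
    push_cast
    ring
  -- (2) the dual energy `∫ Σ_l|∂_{0,l}η|² ψ²/W = L⁻³ κ S`
  have hdual : ∫⁻ X in cellN (m + 1) L, ENNReal.ofReal
      ((∑ l : Fin 3, ‖fderiv ℝ η X (Pi.single 0 (EuclideanSpace.single l (1 : ℝ)))‖ ^ 2) /
        (fibreW Φ X / fibrePsi Φ X ^ 2)) =
      ENNReal.ofReal ((L ^ 3)⁻¹ * κ * ∫ X in cellN (m + 1) L, ‖A X‖ ^ 2 * fibreW Φ X) := by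
    have hpt : ∀ X, ENNReal.ofReal
        ((∑ l : Fin 3, ‖fderiv ℝ η X (Pi.single 0 (EuclideanSpace.single l (1 : ℝ)))‖ ^ 2) /
          (fibreW Φ X / fibrePsi Φ X ^ 2)) =
        ENNReal.ofReal (κ * (‖A X‖ ^ 2 * fibreW Φ X) * fibrePsi Φ X ^ 2) := by
      intro X
      rw [hsum X]
      congr 1
      field_simp [(hWpos X).ne', (hψpos X).ne']
    simp_rw [hpt]
    have hmeas : Measurable fun X =>
        ENNReal.ofReal (κ * (‖A X‖ ^ 2 * fibreW Φ X) * fibrePsi Φ X ^ 2) :=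
      ((continuous_const.mul ((hAc.norm.pow 2).mul hWc)).mul (hψc.pow 2)).measurable.ennreal_ofReal
    rw [lintegral_cellN_eq_fibre_average hL hmeas]
    have hinner : ∀ X, ∫⁻ y in cell L, ENNReal.ofReal (κ * (‖A (Function.update X 0 y)‖ ^ 2 *
        fibreW Φ (Function.update X 0 y)) * fibrePsi Φ (Function.update X 0 y) ^ 2) =
        ENNReal.ofReal (κ * (‖A X‖ ^ 2 * fibreW Φ X)) := by
      intro X
      simp_rw [hAu, fibreW_update]
      have hnn : 0 ≤ κ * (‖A X‖ ^ 2 * fibreW Φ X) :=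
        mul_nonneg hκ0 (mul_nonneg (sq_nonneg _) (hWpos X).le)
      simp_rw [ENNReal.ofReal_mul hnn]
      rw [lintegral_const_mul' _ _ ENNReal.ofReal_ne_top]
      have hsl : Continuous fun y : Space => fibrePsi Φ (Function.update X 0 y) ^ 2 :=
        (hψc.comp (continuous_const.update 0 continuous_id)).pow 2
      rw [← ofReal_integral_eq_lintegral_ofReal (integrableOn_cell hsl)
        (Filter.Eventually.of_forall fun y => sq_nonneg _), integral_fibrePsi_sq hL Φ hΦ X,
        ENNReal.ofReal_one, mul_one]
    simp_rw [hinner]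
    have hnn' : ∀ X, 0 ≤ κ * (‖A X‖ ^ 2 * fibreW Φ X) := fun X =>
      mul_nonneg hκ0 (mul_nonneg (sq_nonneg _) (hWpos X).le)
    have hint : IntegrableOn (fun X => κ * (‖A X‖ ^ 2 * fibreW Φ X)) (cellN (m + 1) L) volume :=
      integrableOn_cellN (continuous_const.mul ((hAc.norm.pow 2).mul hWc)) L
    rw [← ofReal_integral_eq_lintegral_ofReal hint (Filter.Eventually.of_forall hnn'),
      integral_const_mul, ← ENNReal.ofReal_inv_of_pos hL3, ← ENNReal.ofReal_mul (inv_nonneg.2 hL3.le)]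
    congr 1
    ring
  -- (3) Cauchy–Schwarz through the pairing
  have hw : ∀ X, 0 < fibreW Φ X / fibrePsi Φ X ^ 2 := fun X =>
    div_pos (hWpos X) (pow_pos (hψpos X) 2)
  have hwm : Measurable fun X => fibreW Φ X / fibrePsi Φ X ^ 2 :=
    (measurable_fibreW Φ).div ((measurable_fibrePsi hL Φ hΦ).pow_const 2)
  have hcost' : ∫⁻ X in cellN (m + 1) L, ENNReal.ofReal
      ((∑ l : Fin 3, ‖J X l‖ ^ 2) * (fibreW Φ X / fibrePsi Φ X ^ 2)) ≤ ENNReal.ofReal K := by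
    simpa only [fibreCost, mul_div_assoc] using hcost
  have hJ' : IsFibreFlow m L σ J := hJ
  set S : ℝ := ∫ X in cellN (m + 1) L, ‖A X‖ ^ 2 * fibreW Φ X with hS
  have hS0 : 0 ≤ S := setIntegral_nonneg (measurableSet_cellN _ _) fun X _ =>
    mul_nonneg (sq_nonneg _) (fibreW_nonneg Φ X)
  have hD : 0 ≤ (L ^ 3)⁻¹ * κ * S := mul_nonneg (mul_nonneg (inv_nonneg.2 hL3.le) hκ0) hS0
  have key := norm_pairing_sq_le hJ' hηd hηp hw hwm hK hD hcost' hdual.le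
  rw [hpairing, Complex.norm_real, Real.norm_eq_abs, sq_abs] at key
  -- `key : (L⁻³ L^{-3/2} S)² ≤ K (L⁻³ κ S)`; clear denominators
  have hsq : (Real.sqrt (L ^ 3))⁻¹ ^ 2 = (L ^ 3)⁻¹ := by
    rw [inv_pow, Real.sq_sqrt hL3.le]
  have key' : S * S ≤ (K * L ^ 6 * κ) * S := by
    have h1 : ((L ^ 3)⁻¹ * (Real.sqrt (L ^ 3))⁻¹ * S) ^ 2 = (L ^ 3)⁻¹ ^ 3 * (S * S) := by
      rw [mul_pow, mul_pow, hsq]; ring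
    have h2 : K * ((L ^ 3)⁻¹ * κ * S) = (L ^ 3)⁻¹ ^ 3 * ((K * L ^ 6 * κ) * S) := by
      field_simp
    rw [h1, h2] at key
    exact le_of_mul_le_mul_left key (by positivity)
  rcases hS0.lt_or_eq with hpos | hzero
  · exact le_of_mul_le_mul_right key' hpos
  · rw [← hzero]
    exact mul_nonneg (mul_nonneg hK (by positivity)) hκ0

/-! ### The crux's datum forces the bound -/

/-- **INFRARED NECESSITY at one datum.** For a zero-free `C¹` periodic state `Φ` on the torus, a
window mode `n ≠ 0`, and ANY fibre flow `J` with weak divergence the crux's charge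
`q = L^{-3/2}(e_n(x₀)ψ − βψ²)` and Thomson cost `≤ C L²/‖n‖²`: for every lattice mode `P`,
`∫_{cell^N} W |ĉ_P(e_n ψ(·|X̂) − β(X̂) ψ(·|X̂)²)|² dX ≤ 4π² C |P|₂²/‖n‖²` (the side `L` cancels).
[folklore] -/
theorem ir_infraredNecessity_datum (hL : 0 < L) {n : Fin 3 → ℤ} (hn : n ≠ 0)
    (Φ : PeriodicTrialState (m + 1) L) (hΦ : ∀ X, Φ.ψ X ≠ 0) {C : ℝ} (hC : 0 ≤ C)
    {J : Config (m + 1) → (Fin 3 → ℂ)}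
    (hJ : HasWeakDiv L J (fun X => ((Real.sqrt (L ^ 3))⁻¹ : ℂ) *
      (phase L n (X 0) * (fibrePsi Φ X : ℂ) - fibreBeta n Φ X * (fibrePsi Φ X : ℂ) ^ 2)))
    (hcost : fibreCost Φ J ≤ ENNReal.ofReal (C * L ^ 2 / ‖(fun j => (n j : ℝ))‖ ^ 2))
    (P : Fin 3 → ℤ) :
    ∫⁻ X in cellN (m + 1) L, ENNReal.ofReal (fibreW Φ X *
        ‖cellFourierCoeff L (fun y => phase L n y * (fibrePsi Φ (Function.update X 0 y) : ℂ) -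
            fibreBeta n Φ X * (fibrePsi Φ (Function.update X 0 y) : ℂ) ^ 2) P‖ ^ 2)
      ≤ ENNReal.ofReal (4 * Real.pi ^ 2 * C * nsq P / ‖(fun j => (n j : ℝ))‖ ^ 2) := by
  have hL3 : (0 : ℝ) < L ^ 3 := by positivity
  have hL6 : (0 : ℝ) < L ^ 6 := by positivity
  have hN : 0 < ‖(fun j => (n j : ℝ))‖ := lt_of_lt_of_le one_pos (one_le_norm_intVec hn)
  have hK : 0 ≤ C * L ^ 2 / ‖(fun j => (n j : ℝ))‖ ^ 2 := by positivity
  have hψC : Continuous fun X => (fibrePsi Φ X : ℂ) :=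
    Complex.continuous_ofReal.comp (continuous_fibrePsi hL Φ hΦ)
  -- the charge
  set σ : Config (m + 1) → ℂ := fun X => ((Real.sqrt (L ^ 3))⁻¹ : ℂ) *
      (phase L n (X 0) * (fibrePsi Φ X : ℂ) - fibreBeta n Φ X * (fibrePsi Φ X : ℂ) ^ 2) with hσ
  have hσc : Continuous σ := by
    rw [hσ]
    exact continuous_const.mul
      ((((contDiff_phase L n (k := 0)).continuous.comp (continuous_apply 0)).mul hψC).sub
        ((continuous_fibreBeta hL n Φ hΦ).mul (hψC.pow 2)))
  -- the fibre beat amplitude `A(X̂) = ∫_cell conj(e_P) (e_n ψ − β ψ²) dy = L³ ĉ_P(…)`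
  set A : Config (m + 1) → ℂ := fun X => ∫ y in cell L, conj (cellWave L P y) *
      (phase L n y * (fibrePsi Φ (Function.update X 0 y) : ℂ) -
        fibreBeta n Φ X * (fibrePsi Φ (Function.update X 0 y) : ℂ) ^ 2) with hA
  have hcoef : ∀ X, cellFourierCoeff L (fun y => phase L n y * (fibrePsi Φ (Function.update X 0 y) : ℂ) -
      fibreBeta n Φ X * (fibrePsi Φ (Function.update X 0 y) : ℂ) ^ 2) P = ((L ^ 3)⁻¹ : ℝ) • A X :=
    fun X => cellFourierCoeff_eq_integral hL _ P
  have hAd : ContDiff ℝ 1 A := by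
    have hψ : ContDiff ℝ 1 fun q : Space × Config (m + 1) =>
        (fibrePsi Φ (Function.update q.2 0 q.1) : ℂ) :=
      Complex.ofRealCLM.contDiff.comp ((contDiff_fibrePsi hL Φ hΦ).comp contDiff_update_zero)
    have hH : ContDiff ℝ 1 fun q : Space × Config (m + 1) => conj (cellWave L P q.1) *
        (phase L n q.1 * (fibrePsi Φ (Function.update q.2 0 q.1) : ℂ) -
          fibreBeta n Φ q.2 * (fibrePsi Φ (Function.update q.2 0 q.1) : ℂ) ^ 2) :=
      (Complex.conjCLE.contDiff.comp
        (((contDiff_cellWave L P).of_le (mod_cast le_top)).comp contDiff_fst)).mul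
        ((((contDiff_phase L n).comp contDiff_fst).mul hψ).sub
          (((contDiff_fibreBeta hL n Φ hΦ).comp contDiff_snd).mul (hψ.pow 2)))
    rw [hA]
    exact contDiff_one_parametric_setIntegral_of_isBounded (μ := volume) (isBounded_cell L)
      (measurableSet_cell L) hH
  have hAu : ∀ X y, A (Function.update X 0 y) = A X := fun X y => by
    simp only [hA, Function.update_idem, fibreBeta_update]
  have hAp : ∀ (X : Config (m + 1)) (i : Fin (m + 1)) (k : Fin 3),
      A (X + Pi.single i (EuclideanSpace.single k L)) = A X := by
    intro X i k
    simp only [hA, fibreBeta_periodic hL]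
    rcases eq_or_ne i 0 with rfl | hi
    · simp only [update_add_single_zero]
    · simp only [update_add_single_of_ne hi, fibrePsi_periodic]
  -- the charge pairs with `e_{−P} conj(A) W` fibre by fibre to `L^{-3/2} |A|² W`
  have hpair : ∀ X : Config (m + 1),
      ∫ y in cell L, σ (Function.update X 0 y) * (phase L (-P) y * (conj (A X) * (fibreW Φ X : ℂ))) =
        ((Real.sqrt (L ^ 3))⁻¹ : ℂ) * ((‖A X‖ ^ 2 * fibreW Φ X : ℝ) : ℂ) := by
    intro X
    have hpt : ∀ y, σ (Function.update X 0 y) * (phase L (-P) y * (conj (A X) * (fibreW Φ X : ℂ))) =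
        ((Real.sqrt (L ^ 3))⁻¹ : ℂ) * (conj (A X) * (fibreW Φ X : ℂ)) *
          (conj (cellWave L P y) * (phase L n y * (fibrePsi Φ (Function.update X 0 y) : ℂ) -
            fibreBeta n Φ X * (fibrePsi Φ (Function.update X 0 y) : ℂ) ^ 2)) := by
      intro y
      simp only [hσ, Function.update_self, fibreBeta_update]
      rw [phase_eq_cellWave L (-P) y, ← conj_cellWave]
      ring
    simp_rw [hpt]
    rw [integral_const_mul]
    change ((Real.sqrt (L ^ 3))⁻¹ : ℂ) * (conj (A X) * (fibreW Φ X : ℂ)) * A X = _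
    rw [mul_assoc, show conj (A X) * (fibreW Φ X : ℂ) * A X = ((‖A X‖ ^ 2 * fibreW Φ X : ℝ) : ℂ) by
      rw [mul_right_comm, Complex.conj_mul']; push_cast; ring]
  -- the master inequality `S ≤ K L⁶ |k_P|²`
  have hmain := ir_master hL Φ hΦ hσc hJ hK hcost P hAd hAu hAp hpair
  -- the goal is `L⁻⁶ S ≤ 4π² C |P|²/‖n‖²`
  have hAc : Continuous A := hAd.continuous
  have hWc : Continuous (fibreW Φ) := continuous_fibreW Φ
  have hpt : ∀ X, ENNReal.ofReal (fibreW Φ X *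
      ‖cellFourierCoeff L (fun y => phase L n y * (fibrePsi Φ (Function.update X 0 y) : ℂ) -
          fibreBeta n Φ X * (fibrePsi Φ (Function.update X 0 y) : ℂ) ^ 2) P‖ ^ 2) =
      ENNReal.ofReal ((L ^ 6)⁻¹) * ENNReal.ofReal (‖A X‖ ^ 2 * fibreW Φ X) := by
    intro X
    rw [hcoef X, norm_smul, Real.norm_of_nonneg (inv_nonneg.2 hL3.le), mul_pow,
      ← ENNReal.ofReal_mul (inv_nonneg.2 hL6.le)]
    congr 1
    rw [show (L ^ 6 : ℝ) = (L ^ 3) ^ 2 by ring, inv_pow]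
    ring
  have hint : IntegrableOn (fun X => ‖A X‖ ^ 2 * fibreW Φ X) (cellN (m + 1) L) volume :=
    integrableOn_cellN ((hAc.norm.pow 2).mul hWc) L
  simp_rw [hpt]
  rw [lintegral_const_mul' _ _ ENNReal.ofReal_ne_top,
    ← ofReal_integral_eq_lintegral_ofReal hint
      (Filter.Eventually.of_forall fun X => mul_nonneg (sq_nonneg _) (fibreW_nonneg Φ X)),
    ← ENNReal.ofReal_mul (inv_nonneg.2 hL6.le)]
  refine ENNReal.ofReal_le_ofReal ?_
  have hN' := hN.ne'
  have hL' := hL.ne'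
  calc (L ^ 6)⁻¹ * ∫ X in cellN (m + 1) L, ‖A X‖ ^ 2 * fibreW Φ X
      ≤ (L ^ 6)⁻¹ * (C * L ^ 2 / ‖(fun j => (n j : ℝ))‖ ^ 2 * L ^ 6 *
          ((2 * Real.pi / L) ^ 2 * nsq P)) :=
        mul_le_mul_of_nonneg_left hmain (inv_nonneg.2 hL6.le)
    _ = 4 * Real.pi ^ 2 * C * nsq P / ‖(fun j => (n j : ℝ))‖ ^ 2 := by
        field_simp
        ring

/-- `FibreConductance` in the line's vocabulary (syntactic: the crux's `let`s `W, ψ, β, q` are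
`fibreW`, `fibrePsi`, `fibreBeta` and the charge above). [folklore] -/
theorem ir_fibreConductance_iff : FibreConductance ↔ LowDensityWindow fun m L n Φ C =>
    ∃ J : Config (m + 1) → (Fin 3 → ℂ),
      HasWeakDiv L J (fun X => ((Real.sqrt (L ^ 3))⁻¹ : ℂ) *
        (phase L n (X 0) * (fibrePsi Φ X : ℂ) - fibreBeta n Φ X * (fibrePsi Φ X : ℂ) ^ 2)) ∧
      fibreCost Φ J ≤ ENNReal.ofReal (C * L ^ 2 / ‖(fun j => (n j : ℝ))‖ ^ 2) :=
  Iff.rfl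

/-- **INFRARED NECESSITY (registered anchor).** The crux `FibreConductance` forces, with its own
constants `ρ₀, C, N₀` and on every exact zero-free datum of its window, the `W`-averaged bound
`∫_{cell^N} W |ĉ_P(e_n ψ(·|X̂) − β ψ(·|X̂)²)|² ≤ 4π² C |P|₂²/‖n‖²` for every lattice mode `P`:
single-mode control of the conditional amplitude next to the resonance `P − n ≈ −n`, i.e. the
infrared input `stub_shellOccupation` is crux-sized (up to the factor `1/p₁`). [folklore] -/
theorem infraredNecessity : FibreConductance →
    LowDensityWindow fun m L n Φ C => ∀ P : Fin 3 → ℤ,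
      ∫⁻ X in cellN (m + 1) L, ENNReal.ofReal (fibreW Φ X *
          ‖cellFourierCoeff L (fun y => phase L n y * (fibrePsi Φ (Function.update X 0 y) : ℂ) -
              fibreBeta n Φ X * (fibrePsi Φ (Function.update X 0 y) : ℂ) ^ 2) P‖ ^ 2)
        ≤ ENNReal.ofReal (4 * Real.pi ^ 2 * C * nsq P / ‖(fun j => (n j : ℝ))‖ ^ 2) := by
  intro h v hv hbdd M hM
  obtain ⟨ρ₀, C, hρ₀, hC, N₀, hmain⟩ := (ir_fibreConductance_iff.1 h) v hv hbdd M hM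
  refine ⟨ρ₀, C, hρ₀, hC, N₀, fun m hm L hL hρ n hn hw Φ hE hz P => ?_⟩
  obtain ⟨J, hJ, hc⟩ := hmain m hm L hL hρ n hn hw Φ hE hz
  exact ir_infraredNecessity_datum hL hn Φ hz hC.le hJ hc P

end Summit.AtomisticToContinuum.BoseEinsteinCondensation.Cruxes.FibreConductance.ParsevalShellBootstrap

end
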